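import Literature.Probability.LatticeModels.TorusFourierProofs
import Literature.MathematicalPhysics.QuantumLattice.OverlapLocality
import Literature.MathematicalPhysics.QuantumLattice.GaugeGroups
import Literature.MathematicalPhysics.QuantumLattice.GrassmannIntegralProofs
import Literature.MathematicalPhysics.QuantumLattice.GrassmannIntegralWilsonProofs
import HarnessLib

/-!
# Route `OverlapPositivityTransfer` (QCD), support item `OverlapMeasurePositivity` (stmt-QuantumFields-11155) —
# helper: the free field is off the overlap exceptional set, `det(Γ₅ · D_W(1, −1, 1)) ≠ 0` on every torus

Clause (i) of the item (the set `det(Γ₅ D_W(U,−1,1)) = 0` is null for product Haar measure) follows from the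
tree's real-analytic zero-set theorem once ONE configuration is off the exceptional set; the witness is the free
field `U ≡ 1`.  In torus Fourier variables the free massless `r = 1` Wilson–Dirac operator acts on each
(momentum, colour) block by the normal symbol `(W − t)·1 + iΣ_μ sin θ_μ γ_μ` with `|symbol|² ≥ t²` (`t ≤ 1`), so
`D_W(1,0,1) − t` is injective for `0 < t ≤ 1`, `det D_W(1,−1,1) ≠ 0`, and `Γ₅² = 1` finishes.  The argument is
the tree's (files `SpectralDefectExtinctionTipNoBindingFreeSymbol` / `…WindowExtinctionKatoFreeIndexZero` of crux
`SpectralDefectExtinction`), INLINED here as local steps of one theorem with Literature-only imports because that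
module chain does not build on the farm at the time of writing.  Nothing new is claimed; no summit is proved.
References: Montvay–Münster §4.2 (free Wilson fermion in momentum space); Neuberger 1998 (overlap kernel).
-/

namespace Summit.QuantumFields.QCD.Theorems.OverlapMeasurePositivity

open Literature.MathematicalPhysics Literature.MathematicalPhysics.QuantumLattice
  Literature.MathematicalPhysics.QuantumFieldTheory Literature.Probability.LatticeModels
open Matrix Complex ZMod Finset
open scoped ComplexConjugate Real

/-- **The free field is off the overlap exceptional set**: `det(Γ₅ · D_W(1, −1, 1)) ≠ 0` on every four-torus.
Inside: `D_W(1,0,1) − t` is injective for `0 < t ≤ 1` (torus Fourier transform, the normal Clifford symbol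
`(W − t)·1 + iΣ_μ sin θ_μ γ_μ` with `|symbol|² ≥ t²`, Plancherel — the tree's Kato-line argument inlined), then
`D_W(1,−1,1) = D_W(1,0,1) + (−1)·1` and `Γ₅² = 1`. [cite: MontvayMunster1994, §4.2 (free Wilson fermion in momentum space)]
[cite: Neuberger1998, eq. (8)] -/
theorem det_gammaFive_mul_wilsonDirac_one_ne_zero {L : ℕ} [NeZero L] :
    (spinorLift gammaFive * wilsonDirac (fundamentalRep (Fin 3)) (1 : GaugeConfig 4 L (Matrix.specialUnitaryGroup (Fin 3) ℂ)) (-1) 1).det ≠ 0 := by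
  -- `D_W(1,0,1) − t` is injective for `0 < t ≤ 1`
  have hinj : ∀ {t : ℝ}, 0 < t → t ≤ 1 → ∀ {ψ : TorusSite 4 L × Fin 3 × Fin 4 → ℂ},
      wilsonDirac (fundamentalRep (Fin 3)) (1 : GaugeConfig 4 L (Matrix.specialUnitaryGroup (Fin 3) ℂ)) 0 1 *ᵥ ψ -
        (t : ℂ) • ψ = 0 → ψ = 0 := by
    intro t ht0 ht1 ψ h
    have torusFourier_add : ∀ (f g : TorusSite 4 L → ℂ) (k : TorusSite 4 L),
        torusFourier (f + g) k = torusFourier f k + torusFourier g k := by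
      intro f g k
      simp only [torusFourier, Pi.add_apply, add_mul, Finset.sum_add_distrib]
    have torusFourier_sub : ∀ (f g : TorusSite 4 L → ℂ) (k : TorusSite 4 L),
        torusFourier (f - g) k = torusFourier f k - torusFourier g k := by
      intro f g k
      simp only [torusFourier, Pi.sub_apply, sub_mul, Finset.sum_sub_distrib]
    have torusFourier_const_mul : ∀ (c : ℂ) (f : TorusSite 4 L → ℂ) (k : TorusSite 4 L),
        torusFourier (fun x => c * f x) k = c * torusFourier f k := by
      intro c f k
      simp only [torusFourier, Finset.mul_sum, mul_assoc]
    have torusFourier_comp_add : ∀ (f : TorusSite 4 L → ℂ) (e k : TorusSite 4 L),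
        torusFourier (fun x => f (x + e)) k = torusChar k e * torusFourier f k := by
      intro f e k
      rw [torusFourier_eq_sum_torusChar, torusFourier_eq_sum_torusChar, Finset.mul_sum]
      refine Fintype.sum_equiv (Equiv.addRight e) _ _ fun x => ?_
      rw [Equiv.coe_addRight, torusChar_add_right, map_mul]
      have h := torusChar_mul_conj k e
      linear_combination (-(f (x + e) * (starRingEnd ℂ) (torusChar k x))) * h
    have torusFourier_comp_sub : ∀ (f : TorusSite 4 L → ℂ) (e k : TorusSite 4 L),
        torusFourier (fun x => f (x - e)) k = conj (torusChar k e) * torusFourier f k := by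
      intro f e k
      have h := torusFourier_comp_add f (-e) k
      simp only [← sub_eq_add_neg, torusChar_neg_right] at h
      exact h
    have torusChar_single : ∀ (k : TorusSite 4 L) (μ : Fin 4),
        torusChar k (Pi.single μ 1) = stdAddChar (k μ) := by
      intro k μ
      classical
      unfold torusChar
      rw [Finset.prod_eq_single μ]
      · simp
      · intro i _ hi
        simp [Pi.single_eq_of_ne hi]
      · simp
    have torusChar_single_eq_exp : ∀ (k : TorusSite 4 L) (μ : Fin 4),
        torusChar k (Pi.single μ 1) = Complex.exp ((2 * π * ((k μ).val : ℝ) / L : ℝ) * I) := by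
      intro k μ
      rw [torusChar_single, stdAddChar_apply, toCircle_apply]
      congr 1
      push_cast
      ring
    have torusFourier_finset_sum : ∀ (s : Finset (Fin 4)) (f : Fin 4 → TorusSite 4 L → ℂ) (k : TorusSite 4 L),
        torusFourier (fun x => ∑ i ∈ s, f i x) k = ∑ i ∈ s, torusFourier (f i) k := by
      intro s f k
      simp only [torusFourier_eq_sum_torusChar, Finset.sum_mul]
      rw [Finset.sum_comm]
    have torusFourier_add' : ∀ (f g : TorusSite 4 L → ℂ) (k : TorusSite 4 L),
        torusFourier (fun x => f x + g x) k = torusFourier f k + torusFourier g k :=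
      fun f g k => torusFourier_add f g k
    have torusFourier_sub' : ∀ (f g : TorusSite 4 L → ℂ) (k : TorusSite 4 L),
        torusFourier (fun x => f x - g x) k = torusFourier f k - torusFourier g k :=
      fun f g k => torusFourier_sub f g k
    have wilsonDirac_one_mulVec_apply : ∀ (ψ : TorusSite 4 L × Fin 3 × Fin 4 → ℂ)
        (x : TorusSite 4 L) (a : Fin 3) (α : Fin 4),
        (wilsonDirac (fundamentalRep (Fin 3)) (1 : GaugeConfig 4 L (Matrix.specialUnitaryGroup (Fin 3) ℂ)) 0 1 *ᵥ ψ) (x, a, α) =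
          4 * ψ (x, a, α) - (1 / 2) * ∑ μ, ∑ β,
            ((1 - euclideanGamma μ) α β * ψ (x + Pi.single μ 1, a, β) +
              (1 + euclideanGamma μ) α β * ψ (x - Pi.single μ 1, a, β)) := by
      intro ψ x a α
      have hf : ∀ μ : Fin 4, ∑ q : TorusSite 4 L × Fin 3 × Fin 4,
          (if q.1 = QuantumFieldTheory.Site.shift x μ then
              (1 - euclideanGamma μ) α q.2.2 * (1 : Matrix (Fin 3) (Fin 3) ℂ) a q.2.1 else 0) * ψ q =
            ∑ β, (1 - euclideanGamma μ) α β * ψ (x + Pi.single μ 1, a, β) := by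
        intro μ
        rw [Fintype.sum_prod_type, Finset.sum_eq_single (QuantumFieldTheory.Site.shift x μ)]
        · rw [Fintype.sum_prod_type, Finset.sum_eq_single a]
          · simp [QuantumFieldTheory.Site.shift]
          · intro b _ hb
            simp [Matrix.one_apply_ne (Ne.symm hb)]
          · simp
        · intro y _ hy
          simp [if_neg hy]
        · simp
      have hb : ∀ μ : Fin 4, ∑ q : TorusSite 4 L × Fin 3 × Fin 4,
          (if x = QuantumFieldTheory.Site.shift q.1 μ then
              (1 + euclideanGamma μ) α q.2.2 * (1 : Matrix (Fin 3) (Fin 3) ℂ) a q.2.1 else 0) * ψ q =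
            ∑ β, (1 + euclideanGamma μ) α β * ψ (x - Pi.single μ 1, a, β) := by
        intro μ
        simp_rw [eq_shift_iff]
        rw [Fintype.sum_prod_type, Finset.sum_eq_single (x - Pi.single μ 1)]
        · rw [Fintype.sum_prod_type, Finset.sum_eq_single a]
          · simp
          · intro b _ hb
            simp [Matrix.one_apply_ne (Ne.symm hb)]
          · simp
        · intro y _ hy
          simp [if_neg hy]
        · simp
      simp only [mulVec, dotProduct, wilsonDirac, of_apply, Pi.one_apply, inv_one, map_one,
        Complex.ofReal_one, one_smul, sub_mul, Finset.sum_sub_distrib]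
      congr 1
      · rw [Finset.sum_eq_single (x, a, α)]
        · simp
        · intro q _ hq
          rw [if_neg (Ne.symm hq), zero_mul]
        · intro h; exact absurd (Finset.mem_univ _) h
      · simp_rw [Finset.mul_sum, Finset.sum_mul]
        rw [Finset.sum_comm]
        refine Finset.sum_congr rfl fun μ _ => ?_
        simp_rw [mul_assoc, ← Finset.mul_sum]
        congr 1
        simp_rw [add_mul, Finset.sum_add_distrib, hf, hb]
    have torusFourier_free_sub_apply : ∀ (ψ : TorusSite 4 L × Fin 3 × Fin 4 → ℂ) (t : ℝ)
        (k : TorusSite 4 L) (a : Fin 3) (α : Fin 4),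
        torusFourier (fun x => (wilsonDirac (fundamentalRep (Fin 3)) (1 : GaugeConfig 4 L (Matrix.specialUnitaryGroup (Fin 3) ℂ)) 0 1 *ᵥ ψ -
            (t : ℂ) • ψ) (x, a, α)) k =
          (((∑ μ, (1 - Real.cos (2 * π * ((k μ).val : ℝ) / L))) - t : ℝ) : ℂ) *
              torusFourier (fun x => ψ (x, a, α)) k +
            I * ∑ β, (∑ μ, ((Real.sin (2 * π * ((k μ).val : ℝ) / L) : ℝ) : ℂ) • euclideanGamma μ) α β *
              torusFourier (fun x => ψ (x, a, β)) k := by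
      intro ψ t k a α
      -- the character at a unit vector and its conjugate, in terms of `cos θ_μ`, `sin θ_μ`
      have hχ : ∀ μ : Fin 4, torusChar k (Pi.single μ 1) =
          ((Real.cos (2 * π * ((k μ).val : ℝ) / L) : ℝ) : ℂ) +
            ((Real.sin (2 * π * ((k μ).val : ℝ) / L) : ℝ) : ℂ) * I := by
        intro μ
        rw [torusChar_single_eq_exp, Complex.exp_mul_I, ← Complex.ofReal_cos, ← Complex.ofReal_sin]
      have hχc : ∀ μ : Fin 4, conj (torusChar k (Pi.single μ 1)) =
          ((Real.cos (2 * π * ((k μ).val : ℝ) / L) : ℝ) : ℂ) -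
            ((Real.sin (2 * π * ((k μ).val : ℝ) / L) : ℝ) : ℂ) * I := by
        intro μ
        rw [hχ, map_add, map_mul, Complex.conj_ofReal, Complex.conj_ofReal, Complex.conj_I]
        ring
      -- one hopping term (direction `μ`, spin component `β`) in Fourier variables
      have h1 : ∀ μ β : Fin 4, torusFourier (fun x =>
          (1 - euclideanGamma μ) α β * ψ (x + Pi.single μ 1, a, β) +
            (1 + euclideanGamma μ) α β * ψ (x - Pi.single μ 1, a, β)) k =
          (if α = β then 2 * ((Real.cos (2 * π * ((k μ).val : ℝ) / L) : ℝ) : ℂ) *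
              torusFourier (fun x => ψ (x, a, β)) k else 0) -
            2 * (((Real.sin (2 * π * ((k μ).val : ℝ) / L) : ℝ) : ℂ) * I) *
              (euclideanGamma μ α β * torusFourier (fun x => ψ (x, a, β)) k) := by
        intro μ β
        rw [torusFourier_add', torusFourier_const_mul, torusFourier_const_mul,
          torusFourier_comp_add (fun x => ψ (x, a, β)), torusFourier_comp_sub (fun x => ψ (x, a, β)),
          hχc, hχ, Matrix.sub_apply, Matrix.add_apply, Matrix.one_apply]
        split_ifs <;> ring
      -- the whole hopping part in Fourier variables
      have hhop : torusFourier (fun x => ∑ μ, ∑ β,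
          ((1 - euclideanGamma μ) α β * ψ (x + Pi.single μ 1, a, β) +
            (1 + euclideanGamma μ) α β * ψ (x - Pi.single μ 1, a, β))) k =
          2 * (∑ μ, ((Real.cos (2 * π * ((k μ).val : ℝ) / L) : ℝ) : ℂ)) *
              torusFourier (fun x => ψ (x, a, α)) k -
            2 * (I * ∑ β, (∑ μ, ((Real.sin (2 * π * ((k μ).val : ℝ) / L) : ℝ) : ℂ) •
              euclideanGamma μ) α β * torusFourier (fun x => ψ (x, a, β)) k) := by
        have h2 : ∀ μ : Fin 4, torusFourier (fun x => ∑ β,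
            ((1 - euclideanGamma μ) α β * ψ (x + Pi.single μ 1, a, β) +
              (1 + euclideanGamma μ) α β * ψ (x - Pi.single μ 1, a, β))) k =
            2 * ((Real.cos (2 * π * ((k μ).val : ℝ) / L) : ℝ) : ℂ) * torusFourier (fun x => ψ (x, a, α)) k -
              2 * (((Real.sin (2 * π * ((k μ).val : ℝ) / L) : ℝ) : ℂ) * I) *
                ∑ β, euclideanGamma μ α β * torusFourier (fun x => ψ (x, a, β)) k := by
          intro μ
          rw [torusFourier_finset_sum, Finset.sum_congr rfl fun β _ => h1 μ β, Finset.sum_sub_distrib,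
            Finset.sum_ite_eq, if_pos (Finset.mem_univ _), ← Finset.mul_sum]
        rw [torusFourier_finset_sum, Finset.sum_congr rfl fun μ _ => h2 μ, Finset.sum_sub_distrib,
          ← Finset.sum_mul, ← Finset.mul_sum]
        congr 1
        simp only [Matrix.sum_apply, Matrix.smul_apply, smul_eq_mul, Finset.mul_sum, Finset.sum_mul]
        conv_lhs => rw [Finset.sum_comm]
        refine Finset.sum_congr rfl fun β _ => Finset.sum_congr rfl fun μ _ => ?_
        ring
      -- assemble
      simp only [Pi.sub_apply, Pi.smul_apply, smul_eq_mul, wilsonDirac_one_mulVec_apply]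
      rw [torusFourier_sub', torusFourier_sub', torusFourier_const_mul, torusFourier_const_mul,
        torusFourier_const_mul, hhop]
      push_cast
      rw [Finset.sum_sub_distrib]
      simp only [Finset.sum_const, Finset.card_univ, Fintype.card_fin]
      ring
    have sum_norm_sq_mulVec_of_conjTranspose_mul_self : ∀ (M : Matrix (Fin 4) (Fin 4) ℂ) (c : ℝ),
        Mᴴ * M = (c : ℂ) • (1 : Matrix (Fin 4) (Fin 4) ℂ) → ∀ v : Fin 4 → ℂ,
          ∑ i, ‖(M *ᵥ v) i‖ ^ 2 = c * ∑ i, ‖v i‖ ^ 2 := by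
      intro M c hM v
      have key : ∀ w : Fin 4 → ℂ, ∑ i, ‖w i‖ ^ 2 = (star w ⬝ᵥ w).re := by
        intro w
        rw [dotProduct, Complex.re_sum]
        refine Finset.sum_congr rfl fun i _ => ?_
        rw [Pi.star_apply, Complex.star_def, ← Complex.normSq_eq_conj_mul_self, Complex.ofReal_re,
          Complex.normSq_eq_norm_sq]
      rw [key, key, star_mulVec, ← dotProduct_mulVec, mulVec_mulVec, hM, smul_mulVec, one_mulVec,
        dotProduct_smul, smul_eq_mul, Complex.re_ofReal_mul]
    have clifford_conjTranspose_mul_self : ∀ (w : ℝ) (s : Fin 4 → ℝ),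
        ((w : ℂ) • (1 : Matrix (Fin 4) (Fin 4) ℂ) + I • ∑ μ, ((s μ : ℝ) : ℂ) • euclideanGamma μ)ᴴ *
            ((w : ℂ) • (1 : Matrix (Fin 4) (Fin 4) ℂ) + I • ∑ μ, ((s μ : ℝ) : ℂ) • euclideanGamma μ) =
          ((w ^ 2 + ∑ μ, s μ ^ 2 : ℝ) : ℂ) • (1 : Matrix (Fin 4) (Fin 4) ℂ) := by
      intro w s
      set Γ : Matrix (Fin 4) (Fin 4) ℂ := ∑ μ, ((s μ : ℝ) : ℂ) • euclideanGamma μ with hΓ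
      -- `Γ` is Hermitian
      have hΓH : Γᴴ = Γ := by
        simp only [hΓ, conjTranspose_sum, conjTranspose_smul, (euclideanGamma_isHermitian _).eq,
          Complex.star_def, Complex.conj_ofReal]
      -- `Γ² = (Σ s_μ²)·1` by the Clifford relations
      have hsm : ∀ (a b : ℂ) (A B : Matrix (Fin 4) (Fin 4) ℂ), (a • A) * (b • B) = (a * b) • (A * B) := by
        intro a b A B
        rw [Matrix.smul_mul, Matrix.mul_smul, smul_smul]
      have hA : Γ * Γ = ∑ μ, ∑ ν, (((s μ : ℝ) : ℂ) * ((s ν : ℝ) : ℂ)) • (euclideanGamma μ * euclideanGamma ν) := by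
        simp only [hΓ, Finset.sum_mul, Finset.mul_sum, hsm]
        exact Finset.sum_comm
      have h2A : Γ * Γ + Γ * Γ =
          ((∑ μ, s μ ^ 2 : ℝ) : ℂ) • (1 : Matrix (Fin 4) (Fin 4) ℂ) +
            ((∑ μ, s μ ^ 2 : ℝ) : ℂ) • (1 : Matrix (Fin 4) (Fin 4) ℂ) := by
        calc Γ * Γ + Γ * Γ
            = ∑ μ, ∑ ν, (((s μ : ℝ) : ℂ) * ((s ν : ℝ) : ℂ)) • (euclideanGamma μ * euclideanGamma ν) +
                ∑ μ, ∑ ν, (((s ν : ℝ) : ℂ) * ((s μ : ℝ) : ℂ)) • (euclideanGamma ν * euclideanGamma μ) := by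
              rw [hA]
              congr 1
              exact Finset.sum_comm
          _ = ∑ μ, ∑ ν, (((s μ : ℝ) : ℂ) * ((s ν : ℝ) : ℂ)) •
                (euclideanGamma μ * euclideanGamma ν + euclideanGamma ν * euclideanGamma μ) := by
              rw [← Finset.sum_add_distrib]
              refine Finset.sum_congr rfl fun μ _ => ?_
              rw [← Finset.sum_add_distrib]
              refine Finset.sum_congr rfl fun ν _ => ?_
              rw [smul_add, mul_comm ((s ν : ℝ) : ℂ)]
          _ = ∑ μ, ∑ ν, (((s μ : ℝ) : ℂ) * ((s ν : ℝ) : ℂ)) •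
                (if μ = ν then (2 : Matrix (Fin 4) (Fin 4) ℂ) else 0) := by
              refine Finset.sum_congr rfl fun μ _ => Finset.sum_congr rfl fun ν _ => ?_
              rw [euclideanGamma_anticomm_holds μ ν]
          _ = ∑ μ, (((s μ : ℝ) : ℂ) * ((s μ : ℝ) : ℂ)) • (2 : Matrix (Fin 4) (Fin 4) ℂ) := by
              refine Finset.sum_congr rfl fun μ _ => ?_
              simp_rw [smul_ite, smul_zero, Finset.sum_ite_eq, Finset.mem_univ, if_true]
          _ = ((∑ μ, s μ ^ 2 : ℝ) : ℂ) • (1 : Matrix (Fin 4) (Fin 4) ℂ) +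
                ((∑ μ, s μ ^ 2 : ℝ) : ℂ) • (1 : Matrix (Fin 4) (Fin 4) ℂ) := by
              rw [show (2 : Matrix (Fin 4) (Fin 4) ℂ) = 1 + 1 from one_add_one_eq_two.symm]
              simp_rw [smul_add]
              rw [Finset.sum_add_distrib, ← Finset.sum_smul]
              push_cast
              simp only [sq]
      have hΓ2 : Γ * Γ = ((∑ μ, s μ ^ 2 : ℝ) : ℂ) • (1 : Matrix (Fin 4) (Fin 4) ℂ) := by
        have h2 : (2 : ℂ) • (Γ * Γ) = (2 : ℂ) • (((∑ μ, s μ ^ 2 : ℝ) : ℂ) • (1 : Matrix (Fin 4) (Fin 4) ℂ)) := by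
          rw [two_smul, two_smul, h2A]
        calc Γ * Γ = (2 : ℂ)⁻¹ • ((2 : ℂ) • (Γ * Γ)) := by
              rw [smul_smul, inv_mul_cancel₀ two_ne_zero, one_smul]
          _ = ((∑ μ, s μ ^ 2 : ℝ) : ℂ) • (1 : Matrix (Fin 4) (Fin 4) ℂ) := by
              rw [h2, smul_smul, inv_mul_cancel₀ two_ne_zero, one_smul]
      -- expand `Mᴴ M`
      have hII : -I * I = 1 := by rw [neg_mul, Complex.I_mul_I, neg_neg]
      rw [conjTranspose_add, conjTranspose_smul, conjTranspose_smul, conjTranspose_one, hΓH,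
        Complex.star_def, Complex.conj_ofReal, Complex.conj_I, add_mul, mul_add, mul_add,
        hsm, hsm, hsm, hsm, Matrix.one_mul, Matrix.mul_one, Matrix.one_mul, hΓ2, smul_smul, hII, one_mul,
        add_assoc (((w : ℂ) * (w : ℂ)) • (1 : Matrix (Fin 4) (Fin 4) ℂ)), ← add_assoc (((w : ℂ) * I) • Γ),
        ← add_smul, show (w : ℂ) * I + -I * (w : ℂ) = 0 by ring, zero_smul, zero_add, ← add_smul]
      congr 1
      push_cast
      ring
    have sum_norm_sq_torusFourier_free_sub : ∀ (ψ : TorusSite 4 L × Fin 3 × Fin 4 → ℂ) (t : ℝ)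
        (k : TorusSite 4 L) (a : Fin 3),
        ∑ α, ‖torusFourier (fun x => (wilsonDirac (fundamentalRep (Fin 3)) (1 : GaugeConfig 4 L (Matrix.specialUnitaryGroup (Fin 3) ℂ)) 0 1 *ᵥ ψ -
            (t : ℂ) • ψ) (x, a, α)) k‖ ^ 2 =
          (((∑ μ, (1 - Real.cos (2 * Real.pi * ((k μ).val : ℝ) / L))) - t) ^ 2 +
              ∑ μ, Real.sin (2 * Real.pi * ((k μ).val : ℝ) / L) ^ 2) *
            ∑ α, ‖torusFourier (fun x => ψ (x, a, α)) k‖ ^ 2 := by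
      intro ψ t k a
      set w : ℝ := (∑ μ, (1 - Real.cos (2 * π * ((k μ).val : ℝ) / L))) - t with hw
      set s : Fin 4 → ℝ := fun μ => Real.sin (2 * π * ((k μ).val : ℝ) / L) with hs
      set v : Fin 4 → ℂ := fun β => torusFourier (fun x => ψ (x, a, β)) k with hv
      set M : Matrix (Fin 4) (Fin 4) ℂ :=
        (w : ℂ) • (1 : Matrix (Fin 4) (Fin 4) ℂ) + I • ∑ μ, ((s μ : ℝ) : ℂ) • euclideanGamma μ with hM
      have hMv : ∀ α, torusFourier (fun x => (wilsonDirac (fundamentalRep (Fin 3))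
          (1 : GaugeConfig 4 L ↥(Matrix.specialUnitaryGroup (Fin 3) ℂ)) 0 1 *ᵥ ψ - (t : ℂ) • ψ)
            (x, a, α)) k = (M *ᵥ v) α := by
        intro α
        rw [torusFourier_free_sub_apply, hM, add_mulVec, smul_mulVec, smul_mulVec, one_mulVec,
          Pi.add_apply, Pi.smul_apply, Pi.smul_apply, smul_eq_mul, smul_eq_mul, mulVec, dotProduct]
      calc ∑ α, ‖torusFourier (fun x => (wilsonDirac (fundamentalRep (Fin 3))
            (1 : GaugeConfig 4 L ↥(Matrix.specialUnitaryGroup (Fin 3) ℂ)) 0 1 *ᵥ ψ - (t : ℂ) • ψ)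
              (x, a, α)) k‖ ^ 2
          = ∑ α, ‖(M *ᵥ v) α‖ ^ 2 := Finset.sum_congr rfl fun α _ => by rw [hMv]
        _ = (w ^ 2 + ∑ μ, s μ ^ 2) * ∑ α, ‖v α‖ ^ 2 :=
            sum_norm_sq_mulVec_of_conjTranspose_mul_self M _ (clifford_conjTranspose_mul_self w s) v
    have freeSymbol_sq_ge_sq : ∀ (t : ℝ), t ≤ 1 → ∀ k : TorusSite 4 L,
        t ^ 2 ≤ ((∑ μ, (1 - Real.cos (2 * Real.pi * ((k μ).val : ℝ) / L))) - t) ^ 2 +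
            ∑ μ, Real.sin (2 * Real.pi * ((k μ).val : ℝ) / L) ^ 2 := by
      intro t ht k
      have hw0 : ∀ μ : Fin 4, 0 ≤ 1 - Real.cos (2 * Real.pi * ((k μ).val : ℝ) / L) := fun μ =>
        sub_nonneg.mpr (Real.cos_le_one _)
      have hs : ∀ μ : Fin 4, Real.sin (2 * Real.pi * ((k μ).val : ℝ) / L) ^ 2 =
          (1 - Real.cos (2 * Real.pi * ((k μ).val : ℝ) / L)) *
            (2 - (1 - Real.cos (2 * Real.pi * ((k μ).val : ℝ) / L))) := fun μ => by
        rw [Real.sin_sq]; ring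
      simp only [Fin.sum_univ_four, hs]
      set a := 1 - Real.cos (2 * Real.pi * ((k 0).val : ℝ) / L)
      set b := 1 - Real.cos (2 * Real.pi * ((k 1).val : ℝ) / L)
      set c := 1 - Real.cos (2 * Real.pi * ((k 2).val : ℝ) / L)
      set d := 1 - Real.cos (2 * Real.pi * ((k 3).val : ℝ) / L)
      have ha := hw0 0; have hb := hw0 1; have hc := hw0 2; have hd := hw0 3
      have ht' : 0 ≤ 1 - t := by linarith
      nlinarith [mul_nonneg ha hb, mul_nonneg ha hc, mul_nonneg ha hd, mul_nonneg hb hc, mul_nonneg hb hd,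
        mul_nonneg hc hd, mul_nonneg ht' ha, mul_nonneg ht' hb, mul_nonneg ht' hc, mul_nonneg ht' hd]
    -- every Fourier coefficient of every colour/spin component vanishes
    have hF : ∀ (k : TorusSite 4 L) (a : Fin 3) (α : Fin 4), torusFourier (fun x => ψ (x, a, α)) k = 0 := by
      intro k a α
      have hq := sum_norm_sq_torusFourier_free_sub ψ t k a
      rw [h] at hq
      have hzero : ∀ β : Fin 4, torusFourier (fun x => (0 : TorusSite 4 L × Fin 3 × Fin 4 → ℂ) (x, a, β)) k = 0 :=
        fun β => by simp [torusFourier]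
      simp only [hzero, norm_zero, ne_eq, OfNat.ofNat_ne_zero, not_false_eq_true, zero_pow,
        Finset.sum_const_zero] at hq
      have hpos : 0 < ((∑ μ, (1 - Real.cos (2 * Real.pi * ((k μ).val : ℝ) / L))) - t) ^ 2 +
          ∑ μ, Real.sin (2 * Real.pi * ((k μ).val : ℝ) / L) ^ 2 :=
        lt_of_lt_of_le (by positivity) (freeSymbol_sq_ge_sq t ht1 k)
      have hsum : ∑ β, ‖torusFourier (fun x => ψ (x, a, β)) k‖ ^ 2 = 0 := by
        rcases mul_eq_zero.1 hq.symm with h1 | h1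
        · exact absurd h1 hpos.ne'
        · exact h1
      have hle : ‖torusFourier (fun x => ψ (x, a, α)) k‖ ^ 2 ≤
          ∑ β, ‖torusFourier (fun x => ψ (x, a, β)) k‖ ^ 2 :=
        Finset.single_le_sum (f := fun β => ‖torusFourier (fun x => ψ (x, a, β)) k‖ ^ 2)
          (fun β _ => by positivity) (Finset.mem_univ α)
      rw [hsum] at hle
      have : ‖torusFourier (fun x => ψ (x, a, α)) k‖ ^ 2 = 0 := le_antisymm hle (by positivity)
      exact norm_eq_zero.1 (pow_eq_zero_iff two_ne_zero |>.1 this)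
    -- Plancherel, component by component
    funext p
    obtain ⟨x, a, α⟩ := p
    have hP := torusFourier_plancherel_holds (d := 4) (L := L) (fun y => ψ (y, a, α))
    simp only [hF, norm_zero, ne_eq, OfNat.ofNat_ne_zero, not_false_eq_true, zero_pow,
      Finset.sum_const_zero] at hP
    have hL : (0 : ℝ) < (L : ℝ) ^ 4 := by
      have : (0 : ℝ) < L := by exact_mod_cast Nat.pos_of_ne_zero (NeZero.ne L)
      positivity
    have hsum : ∑ y, ‖ψ (y, a, α)‖ ^ 2 = 0 := by
      rcases mul_eq_zero.1 hP.symm with h1 | h1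
      · exact absurd h1 hL.ne'
      · exact h1
    have hx := (Finset.sum_eq_zero_iff_of_nonneg (fun y _ => by positivity)).1 hsum x (Finset.mem_univ x)
    exact norm_eq_zero.1 (pow_eq_zero_iff two_ne_zero |>.1 hx)
  have hmass : wilsonDirac (fundamentalRep (Fin 3)) (1 : GaugeConfig 4 L (Matrix.specialUnitaryGroup (Fin 3) ℂ)) (-1) 1 =
      wilsonDirac (fundamentalRep (Fin 3)) (1 : GaugeConfig 4 L (Matrix.specialUnitaryGroup (Fin 3) ℂ)) 0 1 + Matrix.scalar _ ((-1 : ℝ) : ℂ) := by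
    ext p q
    rw [Matrix.add_apply, Matrix.scalar_apply]
    simp only [wilsonDirac, Matrix.of_apply, Matrix.diagonal_apply]
    by_cases hpq : p = q
    · rw [if_pos hpq, if_pos hpq, if_pos hpq]; push_cast; ring
    · rw [if_neg hpq, if_neg hpq, if_neg hpq, add_zero]
  have hD : (wilsonDirac (fundamentalRep (Fin 3)) (1 : GaugeConfig 4 L (Matrix.specialUnitaryGroup (Fin 3) ℂ)) (-1) 1).det ≠ 0 := by
    intro hdet
    obtain ⟨ψ, hψ, hDψ⟩ := Matrix.exists_mulVec_eq_zero_iff.2 hdet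
    apply hψ
    refine hinj (t := 1) one_pos le_rfl ?_
    rw [hmass, add_mulVec, scalar_apply, ← smul_one_eq_diagonal, smul_mulVec, one_mulVec] at hDψ
    rw [Complex.ofReal_one]
    rw [Complex.ofReal_neg, Complex.ofReal_one, neg_smul, ← sub_eq_add_neg] at hDψ
    exact hDψ
  rw [det_mul]
  refine mul_ne_zero ?_ hD
  intro h0
  have h1 := congrArg Matrix.det (spinorLift_gammaFive_mul_self (L := L) (N := 3))
  rw [det_mul, h0, zero_mul, det_one] at h1
  exact zero_ne_one h1

end Summit.QuantumFields.QCD.Theorems.OverlapMeasurePositivity
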